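import Mathlib
import HarnessLib
import Literature.MathematicalPhysics.QuantumLattice.GaugeGroups
import Literature.MathematicalPhysics.QuantumFieldTheory.ConstructiveQFTWave0
import Literature.MathematicalPhysics.QuantumFieldTheory.U1GinibreComparison
import Summits.Ventures.LatticeQCDFlow.Scaling.PlaquetteMarginals2D
import Summits.Ventures.LatticeQCDFlow.Scaling.LatticeEntropyU1
import Summits.Ventures.LatticeQCDFlow.Scaling.FluxTunnelling

/-!
# LatticeQCDFlow / Scaling — the EXPLICIT `U(1)` patch-action tails and single-link tunnelling law in two dimensions

HONEST FRAMING: exact (Metropolis-corrected) sampling algorithms for lattice gauge theory; figures of merit are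
autocorrelation/cost numbers at stated couplings and volumes; no continuum-physics claim.

Venture `LatticeQCDFlow` (cell pub-lqcd), topic `Scaling`, FANOUT row 30 (lean-1) — OUR WORK, file 4 (assembly) of
the explicit `U(1)` tunnelling law in `d = 2` (the STEP-0 setting).  Theory-2's link-local tunnelling law
(`Scaling/FluxTunnelling.lean`, `Flux.compProd_topCharge_ne_le_of_links_sharp`) prices every change of the plane
topological charge by an exact single-link sampler by `2·μ{S_P ≥ 2}`, the Gibbs mass of the two plaquettes at the
link having `β = 1` action `≥ 2`; that mass entered there as a hypothesis.  Here it is BOUNDED for the 2-d Wilson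
measure `μ_{β,L}` of `U(1)` at every EVEN volume, with no cluster expansion and no character expansion:

* **`u1_pow_mul_lintegral_le`** — PATCH COMPARISON: for `L` even, `β ≥ 0`, a patch `P` of sites and `n` with
  `#P ≤ 2n`, `2n + 2 ≤ L²`, and `f ≥ 0` depending only on the plaquettes of `P`,
  `z₁(β)^{n + #P} · ∫ f(U_·) dμ_{β,L} ≤ ∫ f(g) ∏_{x∈P} w_β(g_x) dHaar^{⊗Λ}(g)`, `w_β(u) = e^{−β(1 − Re u)}`,
  `z₁(β) = ∫ w_β dHaar` — i.e. `μ_{β,L}`-probabilities of `P`-plaquette events are at most `z₁^{−n}` times the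
  probabilities under INDEPENDENT one-plaquette laws (puncture `Scaling/PlaquetteMarginals2D.lean` + the
  Cauchy–Schwarz ratio chain `Scaling/HaarConvolutionRatio.lean` + `∫(K_w w)² ≥ (∫ K_w w)² = z₁⁴`, `∫ w² ≤ z₁`);
* **`u1_pow_mul_measure_patchAction_ge_le`** — PATCH-ACTION TAIL: `z₁(β)^{n + #P} · μ_{β,L}{S_P ≥ c} ≤ e^{−βc}`;
* **`u1_tunnelling_single_link`** — THE EXPLICIT FREEZING LAW: for every even `L ≥ 2`, `β ≥ 0`, every link `e₀`
  and every `μ_{β,L}`-invariant Markov kernel whose steps a.s. change only `e₀` (heat bath, Metropolis, any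
  proposal + filter), `z₁(β)³ · (μ_{β,L} ⊗ κ){Q ≠ Q'} ≤ 2·e^{−2β}`; with `z₁(β) ≥ e^{−1/2}/(π√β)` (`β ≥ 1`,
  `one_le_z1_mul`) this is `(μ_{β,L} ⊗ κ){Q ≠ Q'} ≤ 2π³e^{3/2}·β^{3/2}·e^{−2β}`: the topological charge of an
  exact single-link chain stays put for `≳ e^{2β}/(280 β^{3/2})` updates, uniformly in the (even) volume.

Odd `L` needs the positivity of the convolution operator (not proved here); the exponent `3/2` is not optimal
(the truth is `∫(K_w w)² ≍ z₁³`, giving `β¹`).  Elementary; nothing is cited as a fact; no `def`.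
-/

noncomputable section

namespace Summit.Ventures.LatticeQCDFlow.Theory2.Lattice.TwoDim

open MeasureTheory ProbabilityTheory Literature.MathematicalPhysics.QuantumFieldTheory
open Literature.MathematicalPhysics.QuantumLattice (u1Rep u1Rep_apply continuous_u1Rep)
open Summit.Ventures.LatticeQCDFlow.Theory2.HaarConv
open scoped ENNReal

variable {L : ℕ}

/-! ## §1. The `U(1)` one-plaquette weight -/

/-- `Re tr u1Rep` is inversion-symmetric (`z⁻¹ = z̄` on the circle). [folklore] -/
theorem u1_trace_re_inv (g : Circle) : (u1Rep g⁻¹).trace.re = (u1Rep g).trace.re := by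
  rw [trace_u1Rep_re, trace_u1Rep_re, Circle.coe_inv_eq_conj, Complex.conj_re]

/-- The weight `w_β(g) = e^{−β(1 − Re g)}` is symmetric. [folklore] -/
theorem u1_weight_symm (β : ℝ) (g : Circle) :
    ENNReal.ofReal (Real.exp (-(β * (((1 : ℕ) : ℝ) - (u1Rep g⁻¹).trace.re)))) =
      ENNReal.ofReal (Real.exp (-(β * (((1 : ℕ) : ℝ) - (u1Rep g).trace.re)))) := by
  rw [u1_trace_re_inv]

/-- The weight vanishes nowhere. [folklore] -/
theorem u1_weight_ne_zero (β : ℝ) (g : Circle) :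
    ENNReal.ofReal (Real.exp (-(β * (((1 : ℕ) : ℝ) - (u1Rep g).trace.re)))) ≠ 0 :=
  (ENNReal.ofReal_pos.mpr (Real.exp_pos _)).ne'

/-- The weight is `≤ 1` for `β ≥ 0`. [folklore] -/
theorem u1_weight_le_one {β : ℝ} (hβ : 0 ≤ β) (g : Circle) :
    ENNReal.ofReal (Real.exp (-(β * (((1 : ℕ) : ℝ) - (u1Rep g).trace.re)))) ≤ 1 :=
  ENNReal.ofReal_le_one.mpr (Real.exp_le_one_iff.mpr
    (neg_nonpos.mpr (mul_nonneg hβ (sub_nonneg.mpr (U1.re_trace_u1Rep_le g)))))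

/-- The weight is `≥ e^{−2β}` for `β ≥ 0` (`1 − Re g ≤ 2`). [folklore] -/
theorem u1_weight_ge {β : ℝ} (hβ : 0 ≤ β) (g : Circle) :
    ENNReal.ofReal (Real.exp (-(2 * β))) ≤
      ENNReal.ofReal (Real.exp (-(β * (((1 : ℕ) : ℝ) - (u1Rep g).trace.re)))) := by
  refine ENNReal.ofReal_le_ofReal (Real.exp_le_exp.mpr ?_)
  have h : -1 ≤ (u1Rep g).trace.re := by
    rw [trace_u1Rep_re]
    have h1 := Complex.abs_re_le_norm (g : ℂ)
    rw [Circle.norm_coe] at h1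
    exact (abs_le.mp h1).1
  simp only [Nat.cast_one]
  nlinarith

/-! ## §2. The patch comparison (even `L`) -/

/-- `K_w w ≥ 0` integrates to `z₁²`: `∫ (K_w w) dHaar = (∫ w)²` (right invariance). [folklore] -/
theorem lintegral_haarConv_self {w : Circle → ℝ≥0∞} (hw : Measurable w) :
    ∫⁻ u, haarConv w w u ∂(haarProbability Circle) = (∫⁻ g, w g ∂(haarProbability Circle)) ^ 2 := by
  unfold haarConv
  rw [lintegral_lintegral_swap ((hw.comp measurable_mul).mul (hw.comp measurable_snd)).aemeasurable]
  have h : ∀ g : Circle, ∫⁻ u, w (u * g) * w g ∂(haarProbability Circle) =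
      (∫⁻ u, w u ∂(haarProbability Circle)) * w g := fun g => by
    have hm : Measurable fun u : Circle => w (u * g) := hw.comp (measurable_mul_const g)
    rw [lintegral_mul_const (w g) hm, lintegral_mul_right_eq_self]
  simp_rw [h]
  rw [lintegral_const_mul _ hw, sq]

/-- **`z₁⁴ ≤ (K_w³ w)(1) = ∫ (K_w w)²`** (Jensen / Cauchy–Schwarz against `1`). [folklore] -/
theorem pow_four_le_iterate_three {w : Circle → ℝ≥0∞} (hw : Measurable w) (hws : ∀ g, w g⁻¹ = w g) :
    (∫⁻ g, w g ∂(haarProbability Circle)) ^ 4 ≤ (haarConv w)^[3] w 1 := by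
  rw [show 3 = 2 * 1 + 1 by norm_num, ← lintegral_iterate_sq hw hws 1, Function.iterate_one,
    show (4 : ℕ) = 2 * 2 by norm_num, pow_mul, ← lintegral_haarConv_self hw]
  have h := lintegral_mul_sq_le (haarProbability Circle) (f := haarConv w w) (g := fun _ => 1)
    (measurable_haarConv hw hw).aemeasurable measurable_const.aemeasurable
  simpa only [mul_one, one_pow, lintegral_one, measure_univ] using h

/-- **`(K_w w)(1) = ∫ w² ≤ z₁`** for `w ≤ 1`. [folklore] -/
theorem iterate_one_le {w : Circle → ℝ≥0∞} (hw1 : ∀ g, w g ≤ 1) :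
    (haarConv w)^[1] w 1 ≤ ∫⁻ g, w g ∂(haarProbability Circle) := by
  rw [Function.iterate_one]
  simp only [haarConv, one_mul]
  exact lintegral_mono fun g => by
    calc w g * w g ≤ w g * 1 := by gcongr; exact hw1 g
      _ = w g := mul_one _

/-- Ratio-chain consequence: `z₁^{3n} · (K_w^{2i+1} w)(1) ≤ (K_w^{2(i+n)+1} w)(1)` for `0 < w ≤ 1` symmetric.
[folklore] -/
theorem pow_mul_iterate_le {w : Circle → ℝ≥0∞} (hw : Measurable w) (hws : ∀ g, w g⁻¹ = w g)
    (hw0 : ∀ g, w g ≠ 0) (hw1 : ∀ g, w g ≤ 1) (i n : ℕ) :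
    (∫⁻ g, w g ∂(haarProbability Circle)) ^ (3 * n) * (haarConv w)^[2 * i + 1] w 1 ≤
      (haarConv w)^[2 * (i + n) + 1] w 1 := by
  set z := ∫⁻ g, w g ∂(haarProbability Circle) with hz
  have hz0 : z ≠ 0 := by
    intro h
    have hae := (lintegral_eq_zero_iff hw).mp h
    obtain ⟨g, hg⟩ := hae.exists
    exact hw0 g hg
  have hzt : z ≠ ⊤ := ne_top_of_le_ne_top ENNReal.one_ne_top (by
    calc z ≤ ∫⁻ _, 1 ∂(haarProbability Circle) := lintegral_mono fun g => hw1 g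
      _ = 1 := by rw [lintegral_one, measure_univ])
  have hchain := iterate_ratio_pow_le hw hws hw0 hw1 i n
  have h4 : z ^ (4 * n) ≤ ((haarConv w)^[3] w 1) ^ n := by
    rw [pow_mul]; exact pow_le_pow_left' (pow_four_le_iterate_three hw hws) n
  have h1 : ((haarConv w)^[1] w 1) ^ n ≤ z ^ n := pow_le_pow_left' (iterate_one_le hw1) n
  -- `z^{4n} X_i ≤ X_i X_1^n ≤ X_0^n X_l ≤ z^n X_l`, then cancel `z^n`
  have key : z ^ n * (z ^ (3 * n) * (haarConv w)^[2 * i + 1] w 1) ≤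
      z ^ n * (haarConv w)^[2 * (i + n) + 1] w 1 :=
    calc z ^ n * (z ^ (3 * n) * (haarConv w)^[2 * i + 1] w 1)
        = (haarConv w)^[2 * i + 1] w 1 * z ^ (4 * n) := by ring
      _ ≤ (haarConv w)^[2 * i + 1] w 1 * ((haarConv w)^[3] w 1) ^ n := by gcongr
      _ ≤ ((haarConv w)^[1] w 1) ^ n * (haarConv w)^[2 * (i + n) + 1] w 1 := hchain
      _ ≤ z ^ n * (haarConv w)^[2 * (i + n) + 1] w 1 := by gcongr
  exact (ENNReal.mul_le_mul_iff_right (pow_ne_zero _ hz0) (ENNReal.pow_ne_top hzt)).mp key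

/-! ## §3. The patch comparison for the 2-d `U(1)` Wilson measure -/

/-- Parity bookkeeping: for `L` even, `L² − 1 = 2·((L² − 2)/2) + 1`. [folklore] -/
theorem sq_sub_one_eq_of_even (hL : 2 ≤ L) (hLe : Even L) : L ^ 2 - 1 = 2 * ((L ^ 2 - 2) / 2) + 1 := by
  obtain ⟨m, rfl⟩ := hLe
  have h4 : (m + m) ^ 2 = 2 * (2 * (m * m)) := by ring
  have hm : 1 ≤ m * m := by nlinarith
  rw [h4]
  omega

/-- **PATCH COMPARISON FOR 2-d `U(1)`** (`L` even, `β ≥ 0`): for a patch `P` of sites, `n` with `#P ≤ 2n` and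
`2n + 2 ≤ L²`, and `f ≥ 0` measurable depending only on the plaquettes of `P`,
`z₁(β)^{n+#P} · ∫ f(U_·) dμ_{β,L} ≤ ∫ f(g)·∏_{x∈P} w_β(g_x) dHaar^{⊗Λ}(g)`: a `P`-plaquette event is at most
`z₁^{−n}` times as likely under the Wilson measure as under INDEPENDENT one-plaquette laws
`z₁⁻¹ w_β dHaar`. [folklore] -/
theorem u1_pow_mul_lintegral_le [NeZero L] (hL : 2 ≤ L) (hLe : Even L) {β : ℝ} (hβ : 0 ≤ β)
    (P : Finset (Site 2 L)) (n : ℕ) (hPn : P.card ≤ 2 * n) (hn : 2 * n + 2 ≤ L ^ 2)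
    {f : (Site 2 L → Circle) → ℝ≥0∞} (hfm : Measurable f)
    (hf : ∀ g g' : Site 2 L → Circle, (∀ x ∈ P, g x = g' x) → f g = f g') :
    z1 u1Rep β ^ (n + P.card) *
        ∫⁻ U, f (fun x => plaquetteHolonomy U x 0 1) ∂(wilsonMeasure (d := 2) (L := L) u1Rep β) ≤
      ∫⁻ g, f g * ∏ x ∈ P, ENNReal.ofReal (Real.exp (-(β * (((1 : ℕ) : ℝ) - (u1Rep (g x)).trace.re))))
        ∂(Measure.pi fun _ : Site 2 L => haarProbability Circle) := by
  classical
  set w : Circle → ℝ≥0∞ :=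
    fun g => ENNReal.ofReal (Real.exp (-(β * (((1 : ℕ) : ℝ) - (u1Rep g).trace.re)))) with hwdef
  have hw : Measurable w := measurable_oneWeight u1Rep continuous_u1Rep β
  have hws : ∀ g, w g⁻¹ = w g := u1_weight_symm β
  have hw0 : ∀ g, w g ≠ 0 := u1_weight_ne_zero β
  have hw1 : ∀ g, w g ≤ 1 := u1_weight_le_one hβ
  -- `L²` as a plain number
  obtain ⟨N, hN⟩ : ∃ N, L ^ 2 = N := ⟨_, rfl⟩
  have hcardU : (Finset.univ : Finset (Site 2 L)).card = N := by
    rw [Finset.card_univ, Fintype.card_fun, ZMod.card, Fintype.card_fin, hN]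
  have hodd : N - 1 = 2 * ((N - 2) / 2) + 1 := by rw [← hN]; exact sq_sub_one_eq_of_even hL hLe
  rw [hN] at hn
  -- a puncture off `P`
  have hcard : P.card < (Finset.univ : Finset (Site 2 L)).card := by rw [hcardU]; omega
  obtain ⟨x₀, -, hx₀⟩ := Finset.exists_mem_notMem_of_card_lt_card hcard
  -- indices: `#X' = N - 1 = 2 l + 1`, `l = i + n`, `#R = k + (2 i + 1)` with `k = 2 n - #P`
  obtain ⟨i, hi⟩ : ∃ i, (N - 2) / 2 = i + n := ⟨(N - 2) / 2 - n, by omega⟩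
  set k := 2 * n - P.card with hk
  have hPsub : P ⊆ Finset.univ.erase x₀ := fun x hx =>
    Finset.mem_erase.mpr ⟨fun h => hx₀ (h ▸ hx), Finset.mem_univ _⟩
  have hRcard : ((Finset.univ.erase x₀) \ P).card = k + (2 * i + 1) := by
    rw [Finset.card_sdiff_of_subset hPsub, Finset.card_erase_of_mem (Finset.mem_univ _), hcardU]
    omega
  -- the three analytic inputs
  have hM : ∀ u, (haarConv w)^[((Finset.univ.erase x₀) \ P).card] w u ≤
      (haarConv w)^[2 * i + 1] w 1 * (∫⁻ g, w g ∂(haarProbability Circle)) ^ k := fun u => by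
    rw [hRcard]; exact iterate_apply_le_pow_mul hw hws i k u
  have hchain := pow_mul_iterate_le hw hws hw0 hw1 i n
  have hZ : partitionFunction (d := 2) (L := L) u1Rep β = (haarConv w)^[2 * (i + n) + 1] w 1 := by
    unfold partitionFunction wilsonWeight
    rw [withDensity_apply _ MeasurableSet.univ, Measure.restrict_univ]
    simp_rw [weight_eq_prod_two u1Rep β]
    rw [lintegral_prod_weight_eq_iterate hL hw hws, hN, hodd, hi]
  have hZ0 : partitionFunction (d := 2) (L := L) u1Rep β ≠ 0 := by
    rw [hZ]; exact iterate_apply_ne_zero hw hw0 _ _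
  have hZt : partitionFunction (d := 2) (L := L) u1Rep β ≠ ⊤ := by
    rw [hZ]; exact ne_top_of_le_ne_top ENNReal.one_ne_top (iterate_apply_le_one hw hw1 _ _)
  -- the Wilson integral as `Z⁻¹ · ∫ f(U_·) ∏ w(U_x) dHaar^E`
  have hfhol : Measurable fun U : GaugeConfig 2 L Circle => f (fun x => plaquetteHolonomy U x 0 1) :=
    hfm.comp (measurable_pi_lambda _ fun x => measurable_plaquetteHolonomy x)
  have hdens : Measurable fun U : GaugeConfig 2 L Circle =>
      ENNReal.ofReal (Real.exp (-β * wilsonAction u1Rep U)) := by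
    have h : (fun U : GaugeConfig 2 L Circle => ENNReal.ofReal (Real.exp (-β * wilsonAction u1Rep U))) =
        fun U => ∏ x, w (plaquetteHolonomy U x 0 1) := funext (weight_eq_prod_two u1Rep β)
    rw [h]
    exact Finset.measurable_prod _ fun x _ => hw.comp (measurable_plaquetteHolonomy x)
  have hint : ∫⁻ U, f (fun x => plaquetteHolonomy U x 0 1) ∂(wilsonMeasure (d := 2) (L := L) u1Rep β) =
      (partitionFunction (d := 2) (L := L) u1Rep β)⁻¹ *
        ∫⁻ U, f (fun x => plaquetteHolonomy U x 0 1) * ∏ x, w (plaquetteHolonomy U x 0 1)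
          ∂(Measure.pi fun _ : Edge 2 L => haarProbability Circle) := by
    unfold wilsonMeasure
    rw [lintegral_smul_measure]
    congr 1
    unfold wilsonWeight
    rw [lintegral_withDensity_eq_lintegral_mul _ hdens hfhol]
    refine lintegral_congr fun U => ?_
    rw [Pi.mul_apply, weight_eq_prod_two u1Rep β U, mul_comm]
  -- the sup bound on `∫ f(U_·) ∏ w(U_x)`
  have hN := lintegral_weight_mul_le hL hw hws x₀ P hx₀ hfm hf hM
  -- assemble
  rw [hint]
  have hkn : n + P.card + k = 3 * n := by omega
  calc z1 u1Rep β ^ (n + P.card) * ((partitionFunction (d := 2) (L := L) u1Rep β)⁻¹ *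
        ∫⁻ U, f (fun x => plaquetteHolonomy U x 0 1) * ∏ x, w (plaquetteHolonomy U x 0 1)
          ∂(Measure.pi fun _ : Edge 2 L => haarProbability Circle))
      ≤ z1 u1Rep β ^ (n + P.card) * ((partitionFunction (d := 2) (L := L) u1Rep β)⁻¹ *
        ((haarConv w)^[2 * i + 1] w 1 * (∫⁻ g, w g ∂(haarProbability Circle)) ^ k *
          ∫⁻ g, f g * ∏ x ∈ P, w (g x) ∂(Measure.pi fun _ : Site 2 L => haarProbability Circle))) := by
        gcongr
    _ = (partitionFunction (d := 2) (L := L) u1Rep β)⁻¹ *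
        ((∫⁻ g, w g ∂(haarProbability Circle)) ^ (3 * n) * (haarConv w)^[2 * i + 1] w 1) *
          ∫⁻ g, f g * ∏ x ∈ P, w (g x) ∂(Measure.pi fun _ : Site 2 L => haarProbability Circle) := by
        rw [← hkn, pow_add]; unfold z1; ring
    _ ≤ (partitionFunction (d := 2) (L := L) u1Rep β)⁻¹ * (haarConv w)^[2 * (i + n) + 1] w 1 *
          ∫⁻ g, f g * ∏ x ∈ P, w (g x) ∂(Measure.pi fun _ : Site 2 L => haarProbability Circle) := by
        gcongr
    _ = ∫⁻ g, f g * ∏ x ∈ P, w (g x) ∂(Measure.pi fun _ : Site 2 L => haarProbability Circle) := by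
        rw [← hZ, ENNReal.inv_mul_cancel hZ0 hZt, one_mul]

/-! ## §4. Patch-action tails and the one-plaquette integral -/

/-- **PATCH-ACTION TAIL** (2-d `U(1)`, `L` even, `β ≥ 0`): with `S_P(U) = Σ_{x∈P} (1 − Re U_x)` and `#P ≤ 2n`,
`2n + 2 ≤ L²`: `z₁(β)^{n+#P} · μ_{β,L}{S_P ≥ c} ≤ e^{−βc}`. [folklore] -/
theorem u1_pow_mul_measure_actionSum_ge_le [NeZero L] (hL : 2 ≤ L) (hLe : Even L) {β : ℝ} (hβ : 0 ≤ β)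
    (P : Finset (Site 2 L)) (n : ℕ) (hPn : P.card ≤ 2 * n) (hn : 2 * n + 2 ≤ L ^ 2) (c : ℝ) :
    z1 u1Rep β ^ (n + P.card) * wilsonMeasure (d := 2) (L := L) u1Rep β
        {U | c ≤ ∑ x ∈ P, (1 - ((plaquetteHolonomy U x 0 1 : Circle) : ℂ).re)} ≤
      ENNReal.ofReal (Real.exp (-(β * c))) := by
  classical
  set E : Set (Site 2 L → Circle) := {g | c ≤ ∑ x ∈ P, (1 - ((g x : Circle) : ℂ).re)} with hE
  have hcont : Continuous fun g : Site 2 L → Circle => ∑ x ∈ P, (1 - ((g x : Circle) : ℂ).re) := by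
    fun_prop
  have hEm : MeasurableSet E := measurableSet_le measurable_const hcont.measurable
  have hS : MeasurableSet {U : GaugeConfig 2 L Circle |
      c ≤ ∑ x ∈ P, (1 - ((plaquetteHolonomy U x 0 1 : Circle) : ℂ).re)} :=
    hEm.preimage (measurable_pi_lambda _ fun x => measurable_plaquetteHolonomy x)
  rw [← lintegral_indicator_one hS]
  have hind : ∀ U : GaugeConfig 2 L Circle,
      {U : GaugeConfig 2 L Circle | c ≤ ∑ x ∈ P, (1 - ((plaquetteHolonomy U x 0 1 : Circle) : ℂ).re)}.indicator
        (1 : GaugeConfig 2 L Circle → ℝ≥0∞) U = E.indicator 1 (fun x => plaquetteHolonomy U x 0 1) := by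
    intro U; simp only [Set.indicator_apply, Set.mem_setOf_eq, hE, Pi.one_apply]
  simp_rw [hind]
  have hdep : ∀ g g' : Site 2 L → Circle, (∀ x ∈ P, g x = g' x) →
      E.indicator (1 : (Site 2 L → Circle) → ℝ≥0∞) g = E.indicator 1 g' := by
    intro g g' hgg'
    have hsum : ∑ x ∈ P, (1 - ((g x : Circle) : ℂ).re) = ∑ x ∈ P, (1 - ((g' x : Circle) : ℂ).re) :=
      Finset.sum_congr rfl fun x hx => by rw [hgg' x hx]
    have hmem : g ∈ E ↔ g' ∈ E := by simp only [hE, Set.mem_setOf_eq, hsum]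
    by_cases hg : g ∈ E
    · rw [Set.indicator_of_mem hg, Set.indicator_of_mem (hmem.mp hg)]; rfl
    · rw [Set.indicator_of_notMem hg, Set.indicator_of_notMem (fun h => hg (hmem.mpr h))]
  refine (u1_pow_mul_lintegral_le hL hLe hβ P n hPn hn (measurable_one.indicator hEm) hdep).trans ?_
  -- on `E` the product weight is `≤ e^{-βc}`
  calc ∫⁻ g, E.indicator 1 g * ∏ x ∈ P,
          ENNReal.ofReal (Real.exp (-(β * (((1 : ℕ) : ℝ) - (u1Rep (g x)).trace.re))))
          ∂(Measure.pi fun _ : Site 2 L => haarProbability Circle)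
      ≤ ∫⁻ _, ENNReal.ofReal (Real.exp (-(β * c))) ∂(Measure.pi fun _ : Site 2 L => haarProbability Circle) := by
        refine lintegral_mono fun g => ?_
        by_cases hg : g ∈ E
        · rw [Set.indicator_of_mem hg, Pi.one_apply, one_mul,
            ← ENNReal.ofReal_prod_of_nonneg (fun _ _ => (Real.exp_pos _).le), ← Real.exp_sum]
          refine ENNReal.ofReal_le_ofReal (Real.exp_le_exp.mpr ?_)
          simp only [trace_u1Rep_re, Nat.cast_one]
          rw [Finset.sum_neg_distrib, ← Finset.mul_sum]
          have hc : c ≤ ∑ x ∈ P, (1 - ((g x : Circle) : ℂ).re) := hg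
          exact neg_le_neg (mul_le_mul_of_nonneg_left hc hβ)
        · rw [Set.indicator_of_notMem hg, zero_mul]; exact bot_le
    _ = ENNReal.ofReal (Real.exp (-(β * c))) := by rw [lintegral_const, measure_univ, mul_one]

/-- `z₁(β) ≥ e^{−2β}` (`β ≥ 0`). [folklore] -/
theorem exp_neg_two_mul_le_z1 {β : ℝ} (hβ : 0 ≤ β) : ENNReal.ofReal (Real.exp (-(2 * β))) ≤ z1 u1Rep β := by
  unfold z1
  calc ENNReal.ofReal (Real.exp (-(2 * β))) = ∫⁻ _, ENNReal.ofReal (Real.exp (-(2 * β))) ∂(haarProbability Circle) := by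
        rw [lintegral_const, measure_univ, mul_one]
    _ ≤ _ := lintegral_mono fun g => u1_weight_ge hβ g

/-- **`z₁(β) ≥ e^{−1/2}/(π√β)`** for `β ≥ 1` (the arc `|θ| ≤ β^{−1/2}` has Haar mass `≥ β^{−1/2}/π` and weight
`≥ e^{−1/2}` there). [folklore] -/
theorem inv_sqrt_le_z1 {β : ℝ} (hβ : 1 ≤ β) :
    ENNReal.ofReal (Real.exp (-(1 / 2)) * (1 / Real.pi * (Real.sqrt β)⁻¹)) ≤ z1 u1Rep β := by
  have hβ0 : 0 < β := by linarith
  set ε : ℝ := (Real.sqrt β)⁻¹ with hε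
  have hsq : 0 < Real.sqrt β := Real.sqrt_pos.mpr hβ0
  have hε0 : 0 < ε := inv_pos.mpr hsq
  have hε1 : ε ≤ 1 := inv_le_one_of_one_le₀ (Real.one_le_sqrt.mpr hβ)
  have hεsq : β * ε ^ 2 = 1 := by
    rw [hε, inv_pow, Real.sq_sqrt hβ0.le, mul_inv_cancel₀ hβ0.ne']
  -- weight on the arc
  have hw : ∀ g ∈ U1.arc ε, ENNReal.ofReal (Real.exp (-(1 / 2))) ≤
      ENNReal.ofReal (Real.exp (-(β * (((1 : ℕ) : ℝ) - (u1Rep g).trace.re)))) := by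
    intro g hg
    obtain ⟨θ, hθ, rfl⟩ := U1.exists_angle_of_mem hε0.le (Set.mem_insert_of_mem _ (Set.mem_union_left _ hg))
    refine ENNReal.ofReal_le_ofReal (Real.exp_le_exp.mpr ?_)
    rw [trace_u1Rep_re, U1.re_coe_exp, Nat.cast_one]
    have hcos := Real.one_sub_sq_div_two_le_cos (x := θ)
    have hθ2 : θ ^ 2 ≤ ε ^ 2 := by
      have := abs_le.mp hθ; nlinarith [sq_abs θ, abs_nonneg θ]
    nlinarith
  -- Haar mass of the arc
  have harc : ENNReal.ofReal (1 / Real.pi * ε) ≤ haarProbability Circle (U1.arc ε) := by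
    refine ENNReal.ofReal_le_of_le_toReal ?_
    have h := U1.haar_arc_ge hε0 hε1
    rwa [Real.rpow_one] at h
  unfold z1
  calc ENNReal.ofReal (Real.exp (-(1 / 2)) * (1 / Real.pi * (Real.sqrt β)⁻¹))
      = ENNReal.ofReal (Real.exp (-(1 / 2))) * ENNReal.ofReal (1 / Real.pi * ε) := by
        rw [ENNReal.ofReal_mul (Real.exp_pos _).le]
    _ ≤ ENNReal.ofReal (Real.exp (-(1 / 2))) * haarProbability Circle (U1.arc ε) := by gcongr
    _ = ∫⁻ g in U1.arc ε, ENNReal.ofReal (Real.exp (-(1 / 2))) ∂(haarProbability Circle) := by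
        rw [setLIntegral_const]
    _ ≤ ∫⁻ g in U1.arc ε, ENNReal.ofReal (Real.exp (-(β * (((1 : ℕ) : ℝ) - (u1Rep g).trace.re))))
          ∂(haarProbability Circle) := setLIntegral_mono (measurable_oneWeight u1Rep continuous_u1Rep β) hw
    _ ≤ _ := setLIntegral_le_lintegral _ _

end Summit.Ventures.LatticeQCDFlow.Theory2.Lattice.TwoDim
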